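import Summits.ValiantsHypothesis.ValiantsHypothesis.Theorems.LacunarySymmetroidMatrixDescartesCensusDoorA34SingularLetterAdjugateCell

/-!
# `MatrixDescartes` census — DOOR A at `(3,4)`: the definite-letter law on EVERY WINDOW-ORDERED support (`3·d₂ < d₃`: the whole hierarchical regime,
# all rails `(0,a,b,N)` with `N > 3b`) — a null-top eighteen with an INDEFINITE rank-two top letter has a NON-DEFINITE BOTTOM letter

HONEST FRAMING.  Object-search cell `pub-symmetroid`, engine seat `val-sym-eng-2` (g4); helper row beside the registered strata line
`Cruxes/DoorA34/Lines/strata.lean` on stmt-ValiantsHypothesis-19980 (`DoorA34 = PosRootLawAt 3 4 18`: OPEN, typed, never asserted here).  The instances of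
…SheetDefiniteLetter(Cells) / …SingularLetterAdjugateCell are per support (`decide`).  Here ONE infinite family is done by hand: on a WINDOW-ORDERED support
(`StrictMono d`, `3·d 2 < d 3`, so the `19` sheet exponents come in three blocks core `<` middle `<` top) three sheet ranks are chamber-free —
`ρ(3d₀) = 0`, `ρ(d₃ + 2d₀) = 10`, `ρ(2d₃ + d₀) = 16` (`sheetRank_bottom/_midBottom/_topBottom_of_windowOrdered`) — so the TOP TEST of the bottom letter reads
`W₀ = (0+10) % 2 + (10+16) % 2 = 0`, which the NEGATIVE adjugate cell (`−adj S₃ ⪰ 0`: the INDEFINITE rank-two top letter — the cell of every null-top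
seventeen of record) forbids for a definite `S₀` (`top_test_of_nullTop_eighteen`):

* `sym_sum_ge_of_two_tops` / `sym_sum_le_of_count_top_le_one` / `sym_sum_ge_mid_of_top_mem` / `sym_sum_le_core_of_top_not_mem` — block bounds;
* **`card_posRoots_le_17_of_windowOrdered_indefTop_definiteBottom`** — `StrictMono d`, `3·d 2 < d 3`, `det S₃ = 0`, `−adj S₃ ⪰ 0`, `S₀` definite (either sign)
  ⇒ `Z₊ ≤ 17`: on the entire hierarchical regime a counterexample to `stub_nullTopCeiling` in the indefinite cell has an indefinite (or degenerate) bottom letter.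

Nothing here bounds anything else; `DoorA34` and the three stubs stay OPEN; registers unchanged; nothing on `MatrixDescartes` (stmt-ValiantsHypothesis-18050) or
`VP ≠ VNP` — VP≠VNP not moved.  [folklore] Descartes (sharp case) bookkeeping; elementary.
-/

-- `Summit.ValiantsHypothesis.ValiantsHypothesis.…` repeats a component by the D-0017 layout
-- (single-conjunct summit), which the `dupNamespace` linter flags; the name is mandated.
set_option linter.dupNamespace false

namespace Summit.ValiantsHypothesis.ValiantsHypothesis.Theorems.LacunarySymmetroidMatrixDescartes.Census

open Polynomial Finset Matrix
open scoped BigOperators Polynomial Matrix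

/-! ## 1. Block bounds for slot exponents (sorted support) -/

/-- A slot with the top letter twice has exponent `≥ 2d₃ + d₀`. [folklore] -/
theorem sym_sum_ge_of_two_tops (d : Fin 4 → ℕ) (hd : StrictMono d) (s : Sym (Fin 4) 3)
    (h2 : 2 ≤ Multiset.count (3 : Fin 4) (s : Multiset (Fin 4))) : 2 * d 3 + d 0 ≤ ((s : Multiset (Fin 4)).map d).sum := by
  have hle0 : ∀ l : Fin 4, d 0 ≤ d l := fun l => hd.monotone (Fin.zero_le l)
  have h3mem : (3 : Fin 4) ∈ (s : Multiset (Fin 4)) := Multiset.count_pos.mp (by omega)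
  obtain ⟨t, ht⟩ := Multiset.exists_cons_of_mem h3mem
  have hct : 1 ≤ Multiset.count (3 : Fin 4) t := by
    rw [ht, Multiset.count_cons_self] at h2; omega
  have h3t : (3 : Fin 4) ∈ t := Multiset.count_pos.mp (by omega)
  obtain ⟨u, hu⟩ := Multiset.exists_cons_of_mem h3t
  have hcu : Multiset.card u = 1 := by
    have hcs : Multiset.card (s : Multiset (Fin 4)) = 3 := Sym.card_coe
    rw [ht, Multiset.card_cons, hu, Multiset.card_cons] at hcs; omega
  have hu0 : d 0 ≤ (u.map d).sum := by
    have h := Multiset.card_nsmul_le_sum (s := u.map d) (a := d 0) (by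
      intro x hx; obtain ⟨l, -, rfl⟩ := Multiset.mem_map.mp hx; exact hle0 l)
    simpa [hcu] using h
  rw [ht, hu, Multiset.map_cons, Multiset.sum_cons, Multiset.map_cons, Multiset.sum_cons]
  omega

/-- A slot without the top letter has exponent `≤ 3d₂`. [folklore] -/
theorem sym_sum_le_core_of_top_not_mem (d : Fin 4 → ℕ) (hd : StrictMono d) (s : Sym (Fin 4) 3) (h3 : (3 : Fin 4) ∉ (s : Multiset (Fin 4))) :
    ((s : Multiset (Fin 4)).map d).sum ≤ 3 * d 2 := by
  have hle2 : ∀ l : Fin 4, l ≠ 3 → d l ≤ d 2 := fun l hl => hd.monotone (by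
    have : (l : ℕ) ≠ 3 := fun h => hl (Fin.ext h)
    have := l.2; show (l : ℕ) ≤ 2; omega)
  have h := Multiset.sum_le_card_nsmul ((s : Multiset (Fin 4)).map d) (d 2) (by
    intro x hx
    obtain ⟨l, hl, rfl⟩ := Multiset.mem_map.mp hx
    exact hle2 l (fun h => h3 (h ▸ hl)))
  simpa [Sym.card_coe] using h

/-- A slot with the top letter at most once has exponent `≤ d₃ + 2d₂`. [folklore] -/
theorem sym_sum_le_of_count_top_le_one (d : Fin 4 → ℕ) (hd : StrictMono d) (s : Sym (Fin 4) 3)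
    (h1 : Multiset.count (3 : Fin 4) (s : Multiset (Fin 4)) ≤ 1) : ((s : Multiset (Fin 4)).map d).sum ≤ d 3 + 2 * d 2 := by
  have hle2 : ∀ l : Fin 4, l ≠ 3 → d l ≤ d 2 := fun l hl => hd.monotone (by
    have : (l : ℕ) ≠ 3 := fun h => hl (Fin.ext h)
    have := l.2; show (l : ℕ) ≤ 2; omega)
  have h23 : d 2 ≤ d 3 := hd.monotone (by decide)
  by_cases hmem : (3 : Fin 4) ∈ (s : Multiset (Fin 4))
  · obtain ⟨t, ht⟩ := Multiset.exists_cons_of_mem hmem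
    have hct : Multiset.card t = 2 := by
      have hcs : Multiset.card (s : Multiset (Fin 4)) = 3 := Sym.card_coe
      rw [ht, Multiset.card_cons] at hcs; omega
    have h3t : (3 : Fin 4) ∉ t := by
      intro h3t
      rw [ht, Multiset.count_cons_self] at h1
      have := Multiset.count_pos.mpr h3t
      omega
    have hsum : (t.map d).sum ≤ 2 * d 2 := by
      have h := Multiset.sum_le_card_nsmul (t.map d) (d 2) (by
        intro x hx
        obtain ⟨l, hl, rfl⟩ := Multiset.mem_map.mp hx
        exact hle2 l (fun h => h3t (h ▸ hl)))
      simpa [hct] using h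
    rw [ht, Multiset.map_cons, Multiset.sum_cons]; omega
  · have := sym_sum_le_core_of_top_not_mem d hd s hmem
    omega

/-- A slot containing the top letter has exponent `≥ d₃ + 2d₀`. [folklore] -/
theorem sym_sum_ge_mid_of_top_mem (d : Fin 4 → ℕ) (hd : StrictMono d) (s : Sym (Fin 4) 3) (h3 : (3 : Fin 4) ∈ (s : Multiset (Fin 4))) :
    d 3 + 2 * d 0 ≤ ((s : Multiset (Fin 4)).map d).sum := by
  have hle0 : ∀ l : Fin 4, d 0 ≤ d l := fun l => hd.monotone (Fin.zero_le l)
  obtain ⟨t, ht⟩ := Multiset.exists_cons_of_mem h3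
  have hct : Multiset.card t = 2 := by
    have hcs : Multiset.card (s : Multiset (Fin 4)) = 3 := Sym.card_coe
    rw [ht, Multiset.card_cons] at hcs; omega
  have ht0 : 2 * d 0 ≤ (t.map d).sum := by
    have h := Multiset.card_nsmul_le_sum (s := t.map d) (a := d 0) (by
      intro x hx; obtain ⟨l, -, rfl⟩ := Multiset.mem_map.mp hx; exact hle0 l)
    simpa [hct] using h
  rw [ht, Multiset.map_cons, Multiset.sum_cons]; omega

/-! ## 2. Three chamber-free sheet ranks on a window-ordered support -/

/-- The slots with at most one top letter: `16` of them. [folklore] -/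
theorem card_slots_count_top_le_one :
    (((Finset.univ : Finset (Sym (Fin 4) 3)).erase (Sym.replicate 3 3)).filter
      (fun s : Sym (Fin 4) 3 => Multiset.count (3 : Fin 4) (s : Multiset (Fin 4)) ≤ 1)).card = 16 := by
  decide

/-- The slots without the top letter: `10` of them. [folklore] -/
theorem card_slots_top_not_mem :
    (((Finset.univ : Finset (Sym (Fin 4) 3)).erase (Sym.replicate 3 3)).filter
      (fun s : Sym (Fin 4) 3 => (3 : Fin 4) ∉ (s : Multiset (Fin 4)))).card = 10 := by
  decide

/-- **`ρ(2d₃ + d₀) = 16`** on a window-ordered support (null-top eighteen). [folklore] -/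
theorem sheetRank_topBottom_of_windowOrdered (d : Fin 4 → ℕ) (hd : StrictMono d) (hwin : 3 * d 2 < d 3) (S : Fin 4 → Matrix (Fin 3) (Fin 3) ℝ)
    (h3 : (S 3).det = 0)
    (h18 : 18 ≤ ((Matrix.det (∑ l, ((X : ℝ[X]) ^ d l) • (S l).map C)).roots.toFinset.filter (fun t => 0 < t)).card) :
    ((Matrix.det (∑ l, ((X : ℝ[X]) ^ d l) • (S l).map C)).support.filter (· < 2 * d 3 + d 0)).card = 16 := by
  classical
  have hinj := sym_sum_injOn_of_nullTop_eighteen d S h3 h18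
  set E := (Finset.univ : Finset (Sym (Fin 4) 3)).erase (Sym.replicate 3 3) with hE
  set σ : Sym (Fin 4) 3 → ℕ := fun s => ((s : Multiset (Fin 4)).map d).sum with hσ
  have hfilt : (Matrix.det (∑ l, ((X : ℝ[X]) ^ d l) • (S l).map C)).support.filter (· < 2 * d 3 + d 0)
      = (E.filter (fun s : Sym (Fin 4) 3 => Multiset.count (3 : Fin 4) (s : Multiset (Fin 4)) ≤ 1)).image σ := by
    rw [support_det_pencil_eq_of_nullTop_eighteen d S h3 h18]
    ext c
    simp only [Finset.mem_filter, Finset.mem_image]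
    constructor
    · rintro ⟨⟨s, hs, rfl⟩, hlt⟩
      refine ⟨s, ⟨hs, ?_⟩, rfl⟩
      by_contra hgt
      have := sym_sum_ge_of_two_tops d hd s (by omega)
      exact absurd hlt (not_lt.mpr this)
    · rintro ⟨s, ⟨hs, hcnt⟩, rfl⟩
      refine ⟨⟨s, hs, rfl⟩, ?_⟩
      have := sym_sum_le_of_count_top_le_one d hd s hcnt
      show ((s : Multiset (Fin 4)).map d).sum < 2 * d 3 + d 0
      omega
  rw [hfilt, Finset.card_image_of_injOn (hinj.mono (by intro s hs; exact (Finset.mem_filter.mp hs).1))]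
  exact card_slots_count_top_le_one

/-- **`ρ(d₃ + 2d₀) = 10`** on a window-ordered support (null-top eighteen). [folklore] -/
theorem sheetRank_midBottom_of_windowOrdered (d : Fin 4 → ℕ) (hd : StrictMono d) (hwin : 3 * d 2 < d 3) (S : Fin 4 → Matrix (Fin 3) (Fin 3) ℝ)
    (h3 : (S 3).det = 0)
    (h18 : 18 ≤ ((Matrix.det (∑ l, ((X : ℝ[X]) ^ d l) • (S l).map C)).roots.toFinset.filter (fun t => 0 < t)).card) :
    ((Matrix.det (∑ l, ((X : ℝ[X]) ^ d l) • (S l).map C)).support.filter (· < d 3 + 2 * d 0)).card = 10 := by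
  classical
  have hinj := sym_sum_injOn_of_nullTop_eighteen d S h3 h18
  set E := (Finset.univ : Finset (Sym (Fin 4) 3)).erase (Sym.replicate 3 3) with hE
  set σ : Sym (Fin 4) 3 → ℕ := fun s => ((s : Multiset (Fin 4)).map d).sum with hσ
  have hfilt : (Matrix.det (∑ l, ((X : ℝ[X]) ^ d l) • (S l).map C)).support.filter (· < d 3 + 2 * d 0)
      = (E.filter (fun s : Sym (Fin 4) 3 => (3 : Fin 4) ∉ (s : Multiset (Fin 4)))).image σ := by
    rw [support_det_pencil_eq_of_nullTop_eighteen d S h3 h18]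
    ext c
    simp only [Finset.mem_filter, Finset.mem_image]
    constructor
    · rintro ⟨⟨s, hs, rfl⟩, hlt⟩
      refine ⟨s, ⟨hs, ?_⟩, rfl⟩
      intro hmem
      have := sym_sum_ge_mid_of_top_mem d hd s hmem
      exact absurd hlt (not_lt.mpr this)
    · rintro ⟨s, ⟨hs, hnot⟩, rfl⟩
      refine ⟨⟨s, hs, rfl⟩, ?_⟩
      have := sym_sum_le_core_of_top_not_mem d hd s hnot
      show ((s : Multiset (Fin 4)).map d).sum < d 3 + 2 * d 0
      omega
  rw [hfilt, Finset.card_image_of_injOn (hinj.mono (by intro s hs; exact (Finset.mem_filter.mp hs).1))]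
  exact card_slots_top_not_mem

/-- **`ρ(3d₀) = 0`**: nothing lies below the bottom cube (sorted support). [folklore] -/
theorem sheetRank_bottom_of_nullTop_eighteen (d : Fin 4 → ℕ) (hd : StrictMono d) (S : Fin 4 → Matrix (Fin 3) (Fin 3) ℝ) (h3 : (S 3).det = 0)
    (h18 : 18 ≤ ((Matrix.det (∑ l, ((X : ℝ[X]) ^ d l) • (S l).map C)).roots.toFinset.filter (fun t => 0 < t)).card) :
    ((Matrix.det (∑ l, ((X : ℝ[X]) ^ d l) • (S l).map C)).support.filter (· < 3 * d 0)).card = 0 := by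
  rw [Finset.card_eq_zero, Finset.filter_eq_empty_iff]
  intro c hc
  rw [support_det_pencil_eq_of_nullTop_eighteen d S h3 h18] at hc
  obtain ⟨s, -, rfl⟩ := Finset.mem_image.mp hc
  exact not_lt.mpr (bottom_le_sym_sum_of_strictMono d hd s)

/-! ## 3. The law on every window-ordered support -/

/-- **WINDOW-ORDERED SUPPORTS, INDEFINITE TOP LETTER ⇒ NON-DEFINITE BOTTOM LETTER.**  On a sorted support with `3·d 2 < d 3`, a pencil with `det S₃ = 0`,
`−adj S₃ ⪰ 0` (the indefinite rank-two cell) and a DEFINITE bottom letter `S₀` has at most `17` distinct positive roots (any real letters for the rest;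
symmetry of the other letters is not used). [folklore] -/
theorem card_posRoots_le_17_of_windowOrdered_indefTop_definiteBottom (d : Fin 4 → ℕ) (hd : StrictMono d) (hwin : 3 * d 2 < d 3)
    (S : Fin 4 → Matrix (Fin 3) (Fin 3) ℝ) (h3 : (S 3).det = 0) (hcell : (-(S 3).adjugate).PosSemidef) (h0 : (S 0).PosDef ∨ (-S 0).PosDef) :
    ((Matrix.det (∑ l, ((X : ℝ[X]) ^ d l) • (S l).map C)).roots.toFinset.filter (fun t => 0 < t)).card ≤ 17 := by
  by_contra hlt
  have h18 : 18 ≤ ((Matrix.det (∑ l, ((X : ℝ[X]) ^ d l) • (S l).map C)).roots.toFinset.filter (fun t => 0 < t)).card := by omega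
  set ρ : ℕ → ℕ := fun e => ((Matrix.det (∑ l, ((X : ℝ[X]) ^ d l) • (S l).map C)).support.filter (· < e)).card with hρ
  obtain ⟨-, t1⟩ := top_test_of_nullTop_eighteen d hd S h3 (by decide : (0 : Fin 4) ≠ 3) h0 h18 ρ (fun e => rfl)
  have w := t1 hcell
  have r0 : ρ (3 * d 0) = 0 := sheetRank_bottom_of_nullTop_eighteen d hd S h3 h18
  have r1 : ρ (2 * d 0 + d 3) = 10 := by
    rw [show 2 * d 0 + d 3 = d 3 + 2 * d 0 by ring]; exact sheetRank_midBottom_of_windowOrdered d hd hwin S h3 h18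
  have r2 : ρ (2 * d 3 + d 0) = 16 := sheetRank_topBottom_of_windowOrdered d hd hwin S h3 h18
  rw [r0, r1, r2] at w
  norm_num at w

end Summit.ValiantsHypothesis.ValiantsHypothesis.Theorems.LacunarySymmetroidMatrixDescartes.Census
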